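import Summits.Ventures.YMGap.Thresholds.ConnectedThreePointTools
import HarnessLib

/-!
# Venture YMGap — C-SUS3: TREE DECAY OF THE CONNECTED THREE-POINT FUNCTION of the `SU(2)`, `d = 4`
# strong-coupling state (every `0 ≤ β_W ≤ β₁ ≤ 9/25`), with constants uniform in the coupling

HONEST FRAMING: venture file of the cell `pub-ymgap` (QuantumFields programme), seat ds-1 (gen 10).  Strong-coupling
LATTICE statements for `SU(2)` lattice Yang–Mills on `ℤ^4` with the Wilson action inside the one-sided vertex-star
window `0 ≤ β_W ≤ 9/25` (tree bare coupling `β_W/2`, `W_q = ½ Re tr U_q`); cumulant estimates of the unique DLR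
state only; nothing about the continuum, confinement at weak coupling, or the Clay problem.  This is the domination
input of the sibling file `CouplingSecondDerivative` (the state is `C²` in the coupling).

For `β₁ ≤ 9/25`, `κ = starRate (R_G β₁)`, `r = e^{−κ/16}`, a Lipschitz cylinder `F` (support `Λ`, constant `K`,
links based within sup-distance `D` of `x₀`, `M = |F(1)| + 2K`), the DLR state `μ` at ANY `0 ≤ β_W ≤ β₁`, and the
connected three-point function `u₃(F; W_q; W_r) = Cov(F W_q, W_r) − ⟨F⟩ Cov(W_q, W_r) − ⟨W_q⟩ Cov(F, W_r)`:
* `su2_abs_threePoint_le_of_sep` — ONE SPLIT: if the supports of `X`, `Y` are `≥ m` from that of `Z`,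
  `|u₃(X; Y; Z)| ≤ 4(2√2)² e^{−κ(m−2)} ((#Λ₁+#Λ₂)(M₁K₂+M₂K₁) + M₁#Λ₂K₂ + M₂#Λ₁K₁) #Λ₃K₃`;
* ★ `su2_abs_threePoint_le` — TREE DECAY: `|u₃(F; W_q; W_r)| ≤ A · r^{‖x₀−x_q‖₁} (r^{‖x₀−x_r‖₁} + r^{‖x_q−x_r‖₁})`
  with ONE `A = 4(2√2)² e^{κ(D+4)} (128(#Λ+4)(32M+K) + 16384 M + 1024 #Λ K)` for the whole window — three
  Dobrushin–Shlosman splits (`r`, `q`, resp. `F` isolated; `threePoint_swap` / `threePoint_rotate`) and the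
  sup-norm triangle inequality (`tree_bound_of_three_splits`);
* ★ `su2_summable_threePoint` — `r ↦ u₃(F; W_q; W_r)` is absolutely summable over all plaquettes of `ℤ⁴` with
  `Σ_r |u₃| ≤ 2 A D₄((1+r)/(1−r))⁴ · r^{‖x₀−x_q‖₁}`, again summable in `q`: the third-order static response
  `Σ_{q,r} |u₃(F; W_q; W_r)|` of every local observable is FINITE on the window (row type C-SUS3).

References (mechanism only): R. L. Dobrushin, S. B. Shlosman (1985/87); B. Simon, *The Statistical Mechanics of
Lattice Gases* I (1993), §II.12 (Ursell functions); M. Duneau, D. Iagolnitzer, B. Souillard, CMP 31 (1973) 191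
(tree decay of truncated correlations — here only `n = 3`, from pair clustering with uniform constants).
-/

noncomputable section

open MeasureTheory ProbabilityTheory Function Finset Filter Topology Real Set
open scoped NNReal
open Literature.MathematicalPhysics.QuantumLattice (LGConfig ZdEdge ZdPlaquette plaquetteEdges fundamentalRep
  fundamentalRep_mem_unitaryGroup ymGibbsMeasures)
open Literature.MathematicalPhysics.QuantumFieldTheory hiding ZdEdge
open Summit.Ventures.YMGap.DSWindow (starRate starRate_pos)
open Summit.Ventures.YMGap.StarWindowGauge (gaugeR gaugeR_lt_one_of_le)
open Summit.Ventures.YMGap.StarLemmaG (gaugeR_nonneg)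
open Summit.Ventures.YMGap.RobustBall (l1 l1_sub_comm numOrient)
open Summit.Ventures.YMGap.LinearResponseBound (summable_and_tsum_base_le)
open Summit.Ventures.YMGap.PlaquetteSusceptibility (l1_le_mul_norm)

namespace Summit.Ventures.YMGap.CouplingResponse

/-- Local shorthand: the normalised plaquette observable `W_q = ½ Re tr U_q` of `SU(2)` on `ℤ⁴`. -/
local notation3 (prettyPrint := false) "W∗" q:max =>
  zdPlaquetteObs (d := 4) (fundamentalRep (Fin 2)) (Prod.fst q) (Prod.snd q).1.1 (Prod.snd q).1.2

/-- `e^{−(κ/4)·n} ≤ (e^{−κ/16})^{‖z‖₁}` when `n = ‖z‖_∞` on `ℤ⁴` (`‖z‖₁ ≤ 4‖z‖_∞`). [folklore] -/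
theorem exp_neg_quarter_supNorm_le_pow {κ : ℝ} (hκ : 0 ≤ κ) (z : Literature.Probability.LatticeModels.Site 4) :
    Real.exp (-(κ / 4 * ‖z‖)) ≤ Real.exp (-(κ / 16)) ^ l1 z := by
  rw [← Real.exp_nat_mul]
  refine Real.exp_le_exp.2 ?_
  have h := l1_le_mul_norm (d := 4) z
  push_cast at h
  nlinarith

/-- `W_q` is a Lipschitz cylinder on the four links of `q` (constant `4·2³`), measurable, `|W_q| ≤ 1`, links based
within `1` of `x_q`, at most `4` of them. [folklore] -/
theorem su2_plaquetteObs_data (q : ZdPlaquette 4) :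
    IsLipschitzCylinder (fundamentalRep (Fin 2)) (W∗ q) (plaquetteEdges q) (4 * (2 : ℝ≥0) ^ 3) ∧
      Measurable (W∗ q) ∧ (∀ U, |(W∗ q) U| ≤ ((1 : ℝ≥0) : ℝ)) ∧
      (∀ e ∈ plaquetteEdges q, ‖e.1 - q.1‖ ≤ ((1 : ℕ) : ℝ)) ∧ ((plaquetteEdges q).card : ℝ) ≤ 4 := by
  have h := isLipschitzCylinder_zdPlaquetteObs (N := 2) (d := 4) q.1 q.2.2
  have hρu : ∀ g, fundamentalRep (Fin 2) g ∈ Matrix.unitaryGroup (Fin 2) ℂ := fundamentalRep_mem_unitaryGroup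
  refine ⟨h, h.measurable, fun U => ?_, fun e he => ?_, ?_⟩
  · simpa using abs_zdPlaquetteObs_le hρu q.1 q.2.1.1 q.2.1.2 U
  · simpa using norm_fst_sub_le_of_mem_plaquetteEdges he
  · exact_mod_cast card_plaquetteEdges_le q

/-- **One Dobrushin–Shlosman split of the connected three-point function** (`SU(2)`, `d = 4`): for the DLR state
`μ` at `0 ≤ β_W ≤ β₁ ≤ 9/25` and Lipschitz cylinders `X` (support `Λ₁`, constant `K₁`, `|X| ≤ M₁`), `Y`
(`Λ₂`, `K₂`, `|Y| ≤ M₂`), `Z` (`Λ₃`, `K₃`) with all base points of `Λ₁ ∪ Λ₂` at sup-distance `≥ m` from those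
of `Λ₃`:
`|u₃(X; Y; Z)| ≤ 4(2√2)² e^{−κ(m−2)} · ((#Λ₁+#Λ₂)(M₁K₂ + M₂K₁) + M₁ #Λ₂K₂ + M₂ #Λ₁K₁) · #Λ₃K₃`
(`abs_threePoint_le` + three explicit clusterings `su2_abs_cov_le_of_sep`, the product `XY` by
`isLipschitzCylinder_mul`). -/
theorem su2_abs_threePoint_le_of_sep {β₁ : ℝ} (h1 : β₁ ≤ 9 / 25) {βW : ℝ} (h0 : 0 ≤ βW) (hβ : βW ≤ β₁)
    {μ : Measure (LGConfig 4 (Matrix.specialUnitaryGroup (Fin 2) ℂ))}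
    (hμ : μ ∈ ymGibbsMeasures (d := 4) (fundamentalRep (Fin 2)) (2 * (βW / 4)))
    {X Y Z : LGConfig 4 (Matrix.specialUnitaryGroup (Fin 2) ℂ) → ℝ} {Λ₁ Λ₂ Λ₃ : Finset (ZdEdge 4)}
    {K₁ K₂ K₃ M₁ M₂ : ℝ≥0}
    (hX : IsLipschitzCylinder (fundamentalRep (Fin 2)) X Λ₁ K₁)
    (hY : IsLipschitzCylinder (fundamentalRep (Fin 2)) Y Λ₂ K₂)
    (hZ : IsLipschitzCylinder (fundamentalRep (Fin 2)) Z Λ₃ K₃)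
    (hM₁ : ∀ U, |X U| ≤ M₁) (hM₂ : ∀ U, |Y U| ≤ M₂) {m : ℕ}
    (h13 : ∀ a ∈ Λ₁, ∀ b ∈ Λ₃, (m : ℝ) ≤ ‖a.1 - b.1‖) (h23 : ∀ a ∈ Λ₂, ∀ b ∈ Λ₃, (m : ℝ) ≤ ‖a.1 - b.1‖) :
    |cov[fun U => X U * Y U, Z; μ] - (∫ U, X U ∂μ) * cov[Y, Z; μ] - (∫ U, Y U ∂μ) * cov[X, Z; μ]| ≤
      4 * (2 * Real.sqrt 2) ^ 2 * Real.exp (-(starRate (gaugeR β₁) * ((m - 2 : ℕ) : ℝ))) *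
        ((((Λ₁.card : ℝ) + Λ₂.card) * ((M₁ : ℝ) * K₂ + M₂ * K₁) + M₁ * (Λ₂.card * K₂) + M₂ * (Λ₁.card * K₁)) *
          ((Λ₃.card : ℝ) * K₃)) := by
  classical
  haveI : IsProbabilityMeasure μ := hμ.1
  have hXY := isLipschitzCylinder_mul hX hY hM₁ hM₂
  have hU : ∀ a ∈ Λ₁ ∪ Λ₂, ∀ b ∈ Λ₃, (m : ℝ) ≤ ‖a.1 - b.1‖ := fun a ha b hb => by
    rcases Finset.mem_union.1 ha with h | h
    · exact h13 a h b hb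
    · exact h23 a h b hb
  have c1 := su2_abs_cov_le_of_sep h1 h0 hβ hμ hXY hZ hU
  have c2 := su2_abs_cov_le_of_sep h1 h0 hβ hμ hY hZ h23
  have c3 := su2_abs_cov_le_of_sep h1 h0 hβ hμ hX hZ h13
  refine (abs_threePoint_le hM₁ hM₂).trans ?_
  set E : ℝ := 4 * (2 * Real.sqrt 2) ^ 2 * Real.exp (-(starRate (gaugeR β₁) * ((m - 2 : ℕ) : ℝ))) with hE
  have hE0 : 0 ≤ E := by positivity
  have hcard : ((Λ₁ ∪ Λ₂).card : ℝ) ≤ (Λ₁.card : ℝ) + Λ₂.card := by exact_mod_cast Finset.card_union_le _ _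
  have hK₃ : 0 ≤ (Λ₃.card : ℝ) * K₃ := by positivity
  have hc1 : |cov[fun U => X U * Y U, Z; μ]| ≤
      E * (((Λ₁.card : ℝ) + Λ₂.card) * ((M₁ : ℝ) * K₂ + M₂ * K₁)) * ((Λ₃.card : ℝ) * K₃) := by
    refine c1.trans ?_
    push_cast
    have : ((Λ₁ ∪ Λ₂).card : ℝ) * ((M₁ : ℝ) * K₂ + M₂ * K₁) ≤ ((Λ₁.card : ℝ) + Λ₂.card) * ((M₁ : ℝ) * K₂ + M₂ * K₁) :=
      mul_le_mul_of_nonneg_right hcard (by positivity)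
    exact mul_le_mul_of_nonneg_right (mul_le_mul_of_nonneg_left this hE0) hK₃
  have hc2 : (M₁ : ℝ) * |cov[Y, Z; μ]| ≤ E * ((M₁ : ℝ) * (Λ₂.card * K₂)) * ((Λ₃.card : ℝ) * K₃) := by
    calc (M₁ : ℝ) * |cov[Y, Z; μ]| ≤ M₁ * (E * ((Λ₂.card : ℝ) * K₂) * ((Λ₃.card : ℝ) * K₃)) :=
          mul_le_mul_of_nonneg_left c2 M₁.2
      _ = _ := by ring
  have hc3 : (M₂ : ℝ) * |cov[X, Z; μ]| ≤ E * ((M₂ : ℝ) * (Λ₁.card * K₁)) * ((Λ₃.card : ℝ) * K₃) := by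
    calc (M₂ : ℝ) * |cov[X, Z; μ]| ≤ M₂ * (E * ((Λ₁.card : ℝ) * K₁) * ((Λ₃.card : ℝ) * K₃)) :=
          mul_le_mul_of_nonneg_left c3 M₂.2
      _ = _ := by ring
  calc _ ≤ _ := add_le_add (add_le_add hc1 hc2) hc3
    _ = _ := by ring

set_option maxHeartbeats 400000 in
/-- ★ **TREE DECAY OF THE CONNECTED THREE-POINT FUNCTION** (`SU(2)`, `d = 4`, hypothesis-free, ONE constant for
the whole window).  For `β₁ ≤ 9/25`, `κ = starRate (R_G β₁)`, `r = e^{−κ/16}`, a Lipschitz cylinder `F` (support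
`Λ`, constant `K`, every link based within sup-distance `D` of `x₀`), the DLR state `μ` at any `0 ≤ β_W ≤ β₁`, and
all plaquettes `q, r` of `ℤ⁴`:
`|u₃(F; W_q; W_r)| ≤ A · r^{‖x₀−x_q‖₁} · (r^{‖x₀−x_r‖₁} + r^{‖x_q−x_r‖₁})`,
`A = 4(2√2)² e^{κ(D+4)} (128(#Λ+4)(32M+K) + 16384 M + 1024 #Λ K)`, `M = |F(1)| + 2K` — decay in the TREE length
`‖x_q − x₀‖ + min(‖x_r − x₀‖, ‖x_r − x_q‖)` (up to the factor `¼` in the rate). -/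
theorem su2_abs_threePoint_le {β₁ : ℝ} (h1 : β₁ ≤ 9 / 25) {βW : ℝ} (h0 : 0 ≤ βW) (hβ : βW ≤ β₁)
    {μ : Measure (LGConfig 4 (Matrix.specialUnitaryGroup (Fin 2) ℂ))}
    (hμ : μ ∈ ymGibbsMeasures (d := 4) (fundamentalRep (Fin 2)) (2 * (βW / 4)))
    {F : LGConfig 4 (Matrix.specialUnitaryGroup (Fin 2) ℂ) → ℝ} {Λ : Finset (ZdEdge 4)} {K : ℝ≥0}
    (hF : IsLipschitzCylinder (fundamentalRep (Fin 2)) F Λ K)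
    {x₀ : Literature.Probability.LatticeModels.Site 4} {D : ℕ} (hD : ∀ e ∈ Λ, ‖e.1 - x₀‖ ≤ D)
    (q r : ZdPlaquette 4) :
    |cov[fun U => F U * (W∗ q) U, W∗ r; μ] - (∫ U, F U ∂μ) * cov[W∗ q, W∗ r; μ] -
        (∫ U, (W∗ q) U ∂μ) * cov[F, W∗ r; μ]| ≤
      4 * (2 * Real.sqrt 2) ^ 2 * Real.exp (starRate (gaugeR β₁) * (D + 4)) *
        (128 * (((Λ.card : ℝ) + 4) * (32 * (|F 1| + 2 * K) + K)) + 16384 * (|F 1| + 2 * K) +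
          1024 * ((Λ.card : ℝ) * K)) *
        Real.exp (-(starRate (gaugeR β₁) / 16)) ^ l1 (x₀ - q.1) *
        (Real.exp (-(starRate (gaugeR β₁) / 16)) ^ l1 (x₀ - r.1) +
          Real.exp (-(starRate (gaugeR β₁) / 16)) ^ l1 (q.1 - r.1)) := by
  classical
  haveI : IsProbabilityMeasure μ := hμ.1
  have hβ₁0 : 0 ≤ β₁ := h0.trans hβ
  have hκ : 0 < starRate (gaugeR β₁) :=
    starRate_pos (gaugeR_nonneg hβ₁0 (by linarith)) (gaugeR_lt_one_of_le hβ₁0 h1)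
  obtain ⟨hWq, hWqm, hWq1, hq1, hcq⟩ := su2_plaquetteObs_data q
  obtain ⟨hWr, hWrm, hWr1, hr1, hcr⟩ := su2_plaquetteObs_data r
  set M : ℝ≥0 := ⟨|F 1| + 2 * K, by positivity⟩ with hMdef
  have hMR : (M : ℝ) = |F 1| + 2 * K := rfl
  have hFM : ∀ U, |F U| ≤ (M : ℝ) := fun U => hF.abs_le U
  -- the three base-point distances (natural numbers) and the triangle inequality
  set a : ℕ := Literature.Probability.LatticeModels.Site.supNorm (x₀ - q.1) with ha
  set b : ℕ := Literature.Probability.LatticeModels.Site.supNorm (x₀ - r.1) with hb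
  set c : ℕ := Literature.Probability.LatticeModels.Site.supNorm (q.1 - r.1) with hc
  have haR : ‖x₀ - q.1‖ = a := Literature.Probability.LatticeModels.Site.norm_eq_supNorm _
  have hbR : ‖x₀ - r.1‖ = b := Literature.Probability.LatticeModels.Site.norm_eq_supNorm _
  have hcR : ‖q.1 - r.1‖ = c := Literature.Probability.LatticeModels.Site.norm_eq_supNorm _
  have hcR' : Literature.Probability.LatticeModels.Site.supNorm (r.1 - q.1) = c := by
    have h : ‖r.1 - q.1‖ = (Literature.Probability.LatticeModels.Site.supNorm (r.1 - q.1) : ℝ) :=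
      Literature.Probability.LatticeModels.Site.norm_eq_supNorm _
    rw [norm_sub_rev, hcR] at h
    exact_mod_cast h.symm
  have htri : (a : ℝ) ≤ b + c := by
    rw [← haR, ← hbR, ← hcR]
    calc ‖x₀ - q.1‖ = ‖(x₀ - r.1) - (q.1 - r.1)‖ := by congr 1; abel
      _ ≤ ‖x₀ - r.1‖ + ‖q.1 - r.1‖ := norm_sub_le _ _
  -- separations for the three splits
  have haR' : Literature.Probability.LatticeModels.Site.supNorm (q.1 - x₀) = a := by
    have h : ‖q.1 - x₀‖ = (Literature.Probability.LatticeModels.Site.supNorm (q.1 - x₀) : ℝ) :=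
      Literature.Probability.LatticeModels.Site.norm_eq_supNorm _
    rw [norm_sub_rev, haR] at h
    exact_mod_cast h.symm
  have hbR' : Literature.Probability.LatticeModels.Site.supNorm (r.1 - x₀) = b := by
    have h : ‖r.1 - x₀‖ = (Literature.Probability.LatticeModels.Site.supNorm (r.1 - x₀) : ℝ) :=
      Literature.Probability.LatticeModels.Site.norm_eq_supNorm _
    rw [norm_sub_rev, hbR] at h
    exact_mod_cast h.symm
  have hA_Λ : ∀ e ∈ Λ, ∀ e' ∈ plaquetteEdges r, ((min b c - (D + 2) : ℕ) : ℝ) ≤ ‖e.1 - e'.1‖ :=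
    sep_of_near hD hr1 (by rw [← hb]; omega)
  have hA_q : ∀ e ∈ plaquetteEdges q, ∀ e' ∈ plaquetteEdges r, ((min b c - (D + 2) : ℕ) : ℝ) ≤ ‖e.1 - e'.1‖ :=
    sep_of_near hq1 hr1 (by rw [← hc]; omega)
  have hB_Λ : ∀ e ∈ Λ, ∀ e' ∈ plaquetteEdges q, ((min a c - (D + 2) : ℕ) : ℝ) ≤ ‖e.1 - e'.1‖ :=
    sep_of_near hD hq1 (by rw [← ha]; omega)
  have hB_r : ∀ e ∈ plaquetteEdges r, ∀ e' ∈ plaquetteEdges q, ((min a c - (D + 2) : ℕ) : ℝ) ≤ ‖e.1 - e'.1‖ :=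
    sep_of_near hr1 hq1 (by rw [hcR']; omega)
  have hC_q : ∀ e ∈ plaquetteEdges q, ∀ e' ∈ Λ, ((min a b - (D + 2) : ℕ) : ℝ) ≤ ‖e.1 - e'.1‖ :=
    sep_of_near hq1 hD (by rw [haR']; omega)
  have hC_r : ∀ e ∈ plaquetteEdges r, ∀ e' ∈ Λ, ((min a b - (D + 2) : ℕ) : ℝ) ≤ ‖e.1 - e'.1‖ :=
    sep_of_near hr1 hD (by rw [hbR']; omega)
  -- the three split bounds
  have SA := su2_abs_threePoint_le_of_sep h1 h0 hβ hμ hF hWq hWr hFM hWq1 hA_Λ hA_q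
  have SB := su2_abs_threePoint_le_of_sep h1 h0 hβ hμ hF hWr hWq hFM hWr1 hB_Λ hB_r
  have SC := su2_abs_threePoint_le_of_sep h1 h0 hβ hμ hWq hWr hF hWq1 hWr1 hC_q hC_r
  rw [← threePoint_swap hF.measurable hWqm hWrm hFM hWq1 hWr1] at SB
  rw [← threePoint_rotate hF.measurable hWqm hWrm hFM hWq1 hWr1] at SC
  -- the brackets are bounded by ONE constant `P`
  set P : ℝ := 128 * (((Λ.card : ℝ) + 4) * (32 * (M : ℝ) + (K : ℝ))) + 16384 * (M : ℝ) +
    1024 * ((Λ.card : ℝ) * (K : ℝ)) with hP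
  have e32 : (((4 : ℝ≥0) * (2 : ℝ≥0) ^ 3 : ℝ≥0) : ℝ) = 32 := by norm_num
  have e1 : ((1 : ℝ≥0) : ℝ) = 1 := by norm_num
  have hΛ0 : (0 : ℝ) ≤ Λ.card := Nat.cast_nonneg _
  have hcq0 : (0 : ℝ) ≤ (plaquetteEdges q).card := Nat.cast_nonneg _
  have hcr0 : (0 : ℝ) ≤ (plaquetteEdges r).card := Nat.cast_nonneg _
  have hbrA := bracket_plaquette_le (L := (Λ.card : ℝ)) (Kr := (K : ℝ)) (Mr := (M : ℝ)) e32 e1 hΛ0 K.2 M.2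
    hcq0 hcq hcr0 hcr
  have hbrB := bracket_plaquette_le (L := (Λ.card : ℝ)) (Kr := (K : ℝ)) (Mr := (M : ℝ)) e32 e1 hΛ0 K.2 M.2
    hcr0 hcr hcq0 hcq
  have hbrC := bracket_cylinder_le (L := (Λ.card : ℝ)) (Kr := (K : ℝ)) (Mr := (M : ℝ)) e32 e1 hΛ0 K.2 M.2
    hcq hcr
  rw [← hP] at hbrA hbrB hbrC
  set C₀ : ℝ := 4 * (2 * Real.sqrt 2) ^ 2 with hC₀
  have TA := SA.trans ((mul_le_mul_of_nonneg_left hbrA (by positivity)).trans_eq (mul_right_comm _ _ _))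
  have TB := SB.trans ((mul_le_mul_of_nonneg_left hbrB (by positivity)).trans_eq (mul_right_comm _ _ _))
  have TC := SC.trans ((mul_le_mul_of_nonneg_left hbrC (by positivity)).trans_eq (mul_right_comm _ _ _))
  have hP0 : 0 ≤ P := by rw [hP]; positivity
  have key := tree_bound_of_three_splits (D := D) (by positivity : 0 ≤ C₀ * P) hκ.le htri TA TB TC
  refine key.trans ?_
  have hpre : 0 ≤ C₀ * P * Real.exp (starRate (gaugeR β₁) * (D + 4)) := by positivity
  have ea := exp_neg_quarter_supNorm_le_pow hκ.le (x₀ - q.1)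
  have eb := exp_neg_quarter_supNorm_le_pow hκ.le (x₀ - r.1)
  have ec := exp_neg_quarter_supNorm_le_pow hκ.le (q.1 - r.1)
  rw [haR] at ea; rw [hbR] at eb; rw [hcR] at ec
  calc C₀ * P * Real.exp (starRate (gaugeR β₁) * (D + 4)) * Real.exp (-(starRate (gaugeR β₁) / 4 * a)) *
        (Real.exp (-(starRate (gaugeR β₁) / 4 * b)) + Real.exp (-(starRate (gaugeR β₁) / 4 * c)))
      ≤ C₀ * P * Real.exp (starRate (gaugeR β₁) * (D + 4)) * Real.exp (-(starRate (gaugeR β₁) / 16)) ^ l1 (x₀ - q.1) *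
        (Real.exp (-(starRate (gaugeR β₁) / 16)) ^ l1 (x₀ - r.1) +
          Real.exp (-(starRate (gaugeR β₁) / 16)) ^ l1 (q.1 - r.1)) := by
        rw [mul_assoc (C₀ * P * Real.exp (starRate (gaugeR β₁) * (D + 4))),
          mul_assoc (C₀ * P * Real.exp (starRate (gaugeR β₁) * (D + 4)))]
        refine mul_le_mul_of_nonneg_left ?_ hpre
        exact mul_le_mul ea (add_le_add eb ec) (by positivity) (by positivity)
    _ = _ := by rw [hC₀, hP, hMR]; ring

/-- ★ **C-SUS3 — absolute summability of the connected three-point function in the last plaquette, with the summed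
bound** (`SU(2)`, `d = 4`, hypothesis-free): under the hypotheses of `su2_abs_threePoint_le`, for every plaquette
`q`, `r ↦ u₃(F; W_q; W_r)` is summable over all plaquettes of `ℤ⁴` and
`Σ_r |u₃(F; W_q; W_r)| ≤ 2 · A · D₄((1+r)/(1−r))⁴ · r^{‖x₀−x_q‖₁}` — rb-p1's lattice `ℓ¹` sums centred at `x₀`
and at `x_q` (`summable_and_tsum_base_le`); the right-hand side is again summable in `q`. -/
theorem su2_summable_threePoint {β₁ : ℝ} (h1 : β₁ ≤ 9 / 25) {βW : ℝ} (h0 : 0 ≤ βW) (hβ : βW ≤ β₁)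
    {μ : Measure (LGConfig 4 (Matrix.specialUnitaryGroup (Fin 2) ℂ))}
    (hμ : μ ∈ ymGibbsMeasures (d := 4) (fundamentalRep (Fin 2)) (2 * (βW / 4)))
    {F : LGConfig 4 (Matrix.specialUnitaryGroup (Fin 2) ℂ) → ℝ} {Λ : Finset (ZdEdge 4)} {K : ℝ≥0}
    (hF : IsLipschitzCylinder (fundamentalRep (Fin 2)) F Λ K)
    {x₀ : Literature.Probability.LatticeModels.Site 4} {D : ℕ} (hD : ∀ e ∈ Λ, ‖e.1 - x₀‖ ≤ D)
    (q : ZdPlaquette 4) :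
    Summable (fun r : ZdPlaquette 4 => cov[fun U => F U * (W∗ q) U, W∗ r; μ] -
        (∫ U, F U ∂μ) * cov[W∗ q, W∗ r; μ] - (∫ U, (W∗ q) U ∂μ) * cov[F, W∗ r; μ]) ∧
      ∑' r : ZdPlaquette 4, |cov[fun U => F U * (W∗ q) U, W∗ r; μ] -
        (∫ U, F U ∂μ) * cov[W∗ q, W∗ r; μ] - (∫ U, (W∗ q) U ∂μ) * cov[F, W∗ r; μ]| ≤
      2 * (4 * (2 * Real.sqrt 2) ^ 2 * Real.exp (starRate (gaugeR β₁) * (D + 4)) *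
        (128 * (((Λ.card : ℝ) + 4) * (32 * (|F 1| + 2 * K) + K)) + 16384 * (|F 1| + 2 * K) +
          1024 * ((Λ.card : ℝ) * K))) *
        (numOrient 4 * ((1 + Real.exp (-(starRate (gaugeR β₁) / 16))) /
          (1 - Real.exp (-(starRate (gaugeR β₁) / 16)))) ^ 4) *
        Real.exp (-(starRate (gaugeR β₁) / 16)) ^ l1 (x₀ - q.1) := by
  have hβ₁0 : 0 ≤ β₁ := h0.trans hβ
  have hκ : 0 < starRate (gaugeR β₁) :=
    starRate_pos (gaugeR_nonneg hβ₁0 (by linarith)) (gaugeR_lt_one_of_le hβ₁0 h1)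
  set ρ : ℝ := Real.exp (-(starRate (gaugeR β₁) / 16)) with hρ
  set A : ℝ := 4 * (2 * Real.sqrt 2) ^ 2 * Real.exp (starRate (gaugeR β₁) * (D + 4)) *
    (128 * (((Λ.card : ℝ) + 4) * (32 * (|F 1| + 2 * K) + K)) + 16384 * (|F 1| + 2 * K) +
      1024 * ((Λ.card : ℝ) * K)) with hA
  have hρ0 : 0 ≤ ρ := (Real.exp_pos _).le
  have hρ1 : ρ < 1 := Real.exp_lt_one_iff.2 (by linarith)
  have hK0 : (0 : ℝ) ≤ K := K.2
  have hA0 : 0 ≤ A := by positivity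
  have hAq : 0 ≤ A * ρ ^ l1 (x₀ - q.1) := by positivity
  have h₀ := summable_and_tsum_base_le (d := 4) hAq hρ0 hρ1 x₀
  have h₁ := summable_and_tsum_base_le (d := 4) hAq hρ0 hρ1 q.1
  have hpt : ∀ r : ZdPlaquette 4, |cov[fun U => F U * (W∗ q) U, W∗ r; μ] -
      (∫ U, F U ∂μ) * cov[W∗ q, W∗ r; μ] - (∫ U, (W∗ q) U ∂μ) * cov[F, W∗ r; μ]| ≤
      A * ρ ^ l1 (x₀ - q.1) * ρ ^ l1 (x₀ - r.1) + A * ρ ^ l1 (x₀ - q.1) * ρ ^ l1 (q.1 - r.1) := by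
    intro r
    have h := su2_abs_threePoint_le h1 h0 hβ hμ hF hD q r
    rw [← hρ, ← hA] at h
    linarith
  have hsumB : Summable fun r : ZdPlaquette 4 =>
      A * ρ ^ l1 (x₀ - q.1) * ρ ^ l1 (x₀ - r.1) + A * ρ ^ l1 (x₀ - q.1) * ρ ^ l1 (q.1 - r.1) := h₀.1.add h₁.1
  have hsum : Summable fun r : ZdPlaquette 4 => |cov[fun U => F U * (W∗ q) U, W∗ r; μ] -
      (∫ U, F U ∂μ) * cov[W∗ q, W∗ r; μ] - (∫ U, (W∗ q) U ∂μ) * cov[F, W∗ r; μ]| :=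
    Summable.of_nonneg_of_le (fun r => abs_nonneg _) hpt hsumB
  refine ⟨hsum.of_abs, ?_⟩
  calc _ ≤ ∑' r : ZdPlaquette 4, (A * ρ ^ l1 (x₀ - q.1) * ρ ^ l1 (x₀ - r.1) +
        A * ρ ^ l1 (x₀ - q.1) * ρ ^ l1 (q.1 - r.1)) := hsum.tsum_le_tsum hpt hsumB
    _ = (∑' r : ZdPlaquette 4, A * ρ ^ l1 (x₀ - q.1) * ρ ^ l1 (x₀ - r.1)) +
        ∑' r : ZdPlaquette 4, A * ρ ^ l1 (x₀ - q.1) * ρ ^ l1 (q.1 - r.1) := h₀.1.tsum_add h₁.1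
    _ ≤ A * ρ ^ l1 (x₀ - q.1) * (numOrient 4 * ((1 + ρ) / (1 - ρ)) ^ 4) +
        A * ρ ^ l1 (x₀ - q.1) * (numOrient 4 * ((1 + ρ) / (1 - ρ)) ^ 4) := add_le_add h₀.2 h₁.2
    _ = _ := by ring

end Summit.Ventures.YMGap.CouplingResponse

end
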